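import Summits.Schanuel.Schanuel.Theorems.ZilberEacAnalyticGerms
import Mathlib.RingTheory.Polynomial.GaussLemma
import Mathlib.RingTheory.Localization.Integral
import Mathlib.FieldTheory.RatFunc.Basic
import HarnessLib

/-!
# The equimodular class, XL: the kernel of the germ evaluation at an algebraic branch is generated
# by the irreducible relation; irreducibility in the row language

HONEST FRAMING.  Cell `pub-schanuel` (Zilber's Exponential-Algebraic Closedness, case ladder;
host summit Schanuel), seat 2, gen 25.  Infrastructure for the transcendence of the logarithm of an
ALGEBRAIC branch of any degree (files XLI–XLIV, the reciprocal-type fibres of `y₀`-degree `≥ 3`):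

* **`dvd_of_germEval₂_eq_zero`**: if `Q ∈ ℂ[s][t]` is irreducible of positive `t`-degree and
  `Q(zGerm, v) = 0` for a germ `v` at `z₁`, then every `R` with `R(zGerm, v) = 0` is a multiple of `Q`
  (Gauss's lemma over `ℂ[s]`, a Bézout identity in `ℂ(s)[t]` with cleared denominators, and the
  transcendence of the coordinate germ).  This is what transports a polynomial identity along one
  analytic branch of `Q = 0` to any other branch.
* **`irreducible_rows_iff`**: for `P ∈ ℂ[x₀, y₀]` and `Q ∈ ℂ[s][t]` with `P(x, y) = Q(x)(y)` for all
  `x, y`, `P` is irreducible iff `Q` is (an explicit ring isomorphism `MvPolynomial (Fin 2) ℂ ≃ ℂ[s][t]`).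

[folklore]; nothing here is specific to Schanuel's conjecture (neither used nor implied).
-/

noncomputable section

open Polynomial

set_option linter.dupNamespace false

namespace Summit.Schanuel.Schanuel.Theorems

/-! ## Part A. The kernel of the germ evaluation -/

/-- **The kernel of `ℂ[s][t] → AGerm z₁`, `s ↦ zGerm`, `t ↦ v`, is generated by any irreducible member
of positive `t`-degree.** [folklore] -/
theorem dvd_of_germEval₂_eq_zero {z₁ : ℂ} (v : AGerm z₁) {Q R : ℂ[X][X]} (hQirr : Irreducible Q)
    (hQ1 : Q.natDegree ≠ 0) (hQ : germEval₂ z₁ v Q = 0) (hR : germEval₂ z₁ v R = 0) : Q ∣ R := by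
  classical
  have hprim : Q.IsPrimitive := hQirr.isPrimitive hQ1
  have hQk : Irreducible (Q.map (algebraMap ℂ[X] (RatFunc ℂ))) :=
    (hprim.irreducible_iff_irreducible_map_fraction_map (K := RatFunc ℂ)).1 hQirr
  by_contra hndvd
  have hndvdk : ¬ Q.map (algebraMap ℂ[X] (RatFunc ℂ)) ∣ R.map (algebraMap ℂ[X] (RatFunc ℂ)) := fun h =>
    hndvd (hprim.dvd_of_fraction_map_dvd_fraction_map h)
  obtain ⟨A, B, hAB⟩ := (hQk.coprime_iff_not_dvd).2 hndvdk
  obtain ⟨c, hc, hA⟩ := IsLocalization.integerNormalization_spec (nonZeroDivisors ℂ[X]) A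
  obtain ⟨d, hd, hB⟩ := IsLocalization.integerNormalization_spec (nonZeroDivisors ℂ[X]) B
  set A₀ := IsLocalization.integerNormalization (nonZeroDivisors ℂ[X]) A with hA₀
  set B₀ := IsLocalization.integerNormalization (nonZeroDivisors ℂ[X]) B with hB₀
  have hc0 : c ≠ 0 := nonZeroDivisors.ne_zero hc
  have hd0 : d ≠ 0 := nonZeroDivisors.ne_zero hd
  -- the cleared Bézout identity in `ℂ[s][t]`
  have hinj : Function.Injective (algebraMap ℂ[X] (RatFunc ℂ)) := IsFractionRing.injective _ _
  have hid : Polynomial.C d * A₀ * Q + Polynomial.C c * B₀ * R = Polynomial.C (c * d) := by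
    apply Polynomial.map_injective (algebraMap ℂ[X] (RatFunc ℂ)) hinj
    rw [Polynomial.map_add, Polynomial.map_mul, Polynomial.map_mul, Polynomial.map_mul,
      Polynomial.map_mul, Polynomial.map_C, Polynomial.map_C, Polynomial.map_C, hA, hB,
      Algebra.smul_def, Algebra.smul_def, Polynomial.algebraMap_apply, Polynomial.algebraMap_apply,
      map_mul, Polynomial.C_mul]
    linear_combination (Polynomial.C (algebraMap ℂ[X] (RatFunc ℂ) c) *
      Polynomial.C (algebraMap ℂ[X] (RatFunc ℂ) d)) * hAB
  have h := congrArg (germEval₂ z₁ v) hid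
  simp only [map_add, map_mul, hQ, hR, mul_zero, add_zero, germEval₂_C] at h
  rw [← map_mul] at h
  exact aeval_zGerm_ne_zero z₁ (mul_ne_zero hc0 hd0) h.symm

/-- Along a branch: if `Q(z, f z) = 0` near `z₁` for an irreducible `Q` of positive `t`-degree, then
`R(z, f z) = 0` near `z₁` iff `Q ∣ R`. [folklore] -/
theorem evalPP_eventually_eq_zero_iff_dvd {z₁ : ℂ} {f : ℂ → ℂ} (hf : AnalyticAt ℂ f z₁) {Q : ℂ[X][X]}
    (hQirr : Irreducible Q) (hQ1 : Q.natDegree ≠ 0)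
    (hQ : ∀ᶠ z in nhds z₁, (Q.map (Polynomial.evalRingHom z)).eval (f z) = 0) (R : ℂ[X][X]) :
    (∀ᶠ z in nhds z₁, (R.map (Polynomial.evalRingHom z)).eval (f z) = 0) ↔ Q ∣ R := by
  constructor
  · intro hR
    have hQ' : germEval₂ z₁ (AGerm.mk z₁ hf) Q = 0 := (germEval₂_mk_eq_zero_iff hf Q).2 hQ
    have hR' : germEval₂ z₁ (AGerm.mk z₁ hf) R = 0 := (germEval₂_mk_eq_zero_iff hf R).2 hR
    exact dvd_of_germEval₂_eq_zero _ hQirr hQ1 hQ' hR'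
  · rintro ⟨S, rfl⟩
    filter_upwards [hQ] with z hz
    rw [Polynomial.map_mul, Polynomial.eval_mul, hz, zero_mul]

/-! ## Part B. Irreducibility in the row language -/

/-- **An explicit ring isomorphism `ℂ[x₀, y₀] ≃ ℂ[s][t]` compatible with evaluation.** [folklore] -/
theorem exists_rowsEquiv :
    ∃ Φ : MvPolynomial (Fin 2) ℂ ≃+* ℂ[X][X], ∀ (P : MvPolynomial (Fin 2) ℂ) (x y : ℂ),
      MvPolynomial.eval ![x, y] P = ((Φ P).map (Polynomial.evalRingHom x)).eval y := by
  classical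
  -- the two algebra homomorphisms
  let F : MvPolynomial (Fin 2) ℂ →ₐ[ℂ] ℂ[X][X] :=
    MvPolynomial.aeval ![Polynomial.C Polynomial.X, Polynomial.X]
  let G₀ : ℂ[X] →ₐ[ℂ] MvPolynomial (Fin 2) ℂ := Polynomial.aeval (MvPolynomial.X 0)
  let G : ℂ[X][X] →ₐ[ℂ] MvPolynomial (Fin 2) ℂ :=
    Polynomial.eval₂AlgHom G₀ (MvPolynomial.X 1) fun a => Commute.all _ _
  have hF0 : F (MvPolynomial.X 0) = Polynomial.C Polynomial.X := by
    simp [F]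
  have hF1 : F (MvPolynomial.X 1) = Polynomial.X := by
    simp [F]
  have hGX : G Polynomial.X = MvPolynomial.X 1 := by
    simp [G, Polynomial.eval₂AlgHom]
  have hGC : ∀ a : ℂ[X], G (Polynomial.C a) = Polynomial.aeval (MvPolynomial.X 0 : MvPolynomial (Fin 2) ℂ) a := by
    intro a
    simp [G, G₀, Polynomial.eval₂AlgHom]
  have hFG : F.comp G = AlgHom.id ℂ ℂ[X][X] := by
    refine Polynomial.algHom_ext' ?_ ?_
    · refine Polynomial.algHom_ext ?_
      rw [AlgHom.comp_apply, AlgHom.comp_apply, AlgHom.comp_apply]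
      change F (G (Polynomial.C Polynomial.X)) = Polynomial.C Polynomial.X
      rw [hGC, Polynomial.aeval_X, hF0]
    · rw [AlgHom.comp_apply, hGX, hF1, AlgHom.id_apply]
  have hGF : G.comp F = AlgHom.id ℂ (MvPolynomial (Fin 2) ℂ) := by
    refine MvPolynomial.algHom_ext fun i => ?_
    rw [AlgHom.comp_apply, AlgHom.id_apply]
    fin_cases i
    · change G (F (MvPolynomial.X 0)) = MvPolynomial.X 0
      rw [hF0, hGC, Polynomial.aeval_X]
    · change G (F (MvPolynomial.X 1)) = MvPolynomial.X 1
      rw [hF1, hGX]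
  let Φ : MvPolynomial (Fin 2) ℂ ≃ₐ[ℂ] ℂ[X][X] := AlgEquiv.ofAlgHom F G hFG hGF
  refine ⟨Φ.toRingEquiv, fun P x y => ?_⟩
  -- both sides are ring homomorphisms `MvPolynomial (Fin 2) ℂ → ℂ` agreeing on generators
  change MvPolynomial.eval ![x, y] P =
    ((Polynomial.evalRingHom y).comp ((Polynomial.mapRingHom (Polynomial.evalRingHom x)).comp
      (F : MvPolynomial (Fin 2) ℂ →+* ℂ[X][X]))) P
  congr 1
  refine MvPolynomial.ringHom_ext (fun c => ?_) (fun i => ?_)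
  · rw [RingHom.comp_apply, RingHom.comp_apply, MvPolynomial.eval_C]
    change c = ((F (MvPolynomial.C c)).map (Polynomial.evalRingHom x)).eval y
    rw [eq_comm, ← MvPolynomial.algebraMap_eq, AlgHom.commutes, Polynomial.algebraMap_apply,
      Polynomial.algebraMap_eq, Polynomial.map_C, Polynomial.eval_C, Polynomial.coe_evalRingHom,
      Polynomial.eval_C]
  · rw [RingHom.comp_apply, RingHom.comp_apply, MvPolynomial.eval_X]
    fin_cases i
    · change (![x, y] : Fin 2 → ℂ) 0 = ((F (MvPolynomial.X 0)).map (Polynomial.evalRingHom x)).eval y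
      rw [hF0]
      simp
    · change (![x, y] : Fin 2 → ℂ) 1 = ((F (MvPolynomial.X 1)).map (Polynomial.evalRingHom x)).eval y
      rw [hF1]
      simp

/-- Two-variable polynomials over `ℂ` with equal values are equal. [folklore] -/
theorem polyPoly_eq_of_eval_eq {Q₁ Q₂ : ℂ[X][X]}
    (h : ∀ x y : ℂ, (Q₁.map (Polynomial.evalRingHom x)).eval y = (Q₂.map (Polynomial.evalRingHom x)).eval y) :
    Q₁ = Q₂ := by
  have hx : ∀ x : ℂ, Q₁.map (Polynomial.evalRingHom x) = Q₂.map (Polynomial.evalRingHom x) :=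
    fun x => Polynomial.funext fun y => h x y
  ext j : 1
  refine Polynomial.funext fun x => ?_
  have := congrArg (fun q : ℂ[X] => q.coeff j) (hx x)
  simpa only [Polynomial.coeff_map, Polynomial.coe_evalRingHom] using this

/-- **Irreducibility transfers between `P ∈ ℂ[x₀, y₀]` and its rows `Q ∈ ℂ[s][t]`.** [folklore] -/
theorem irreducible_rows_iff {P : MvPolynomial (Fin 2) ℂ} {Q : ℂ[X][X]}
    (hPQ : ∀ x y : ℂ, MvPolynomial.eval ![x, y] P = (Q.map (Polynomial.evalRingHom x)).eval y) :
    Irreducible P ↔ Irreducible Q := by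
  obtain ⟨Φ, hΦ⟩ := exists_rowsEquiv
  have hΦP : Φ P = Q := polyPoly_eq_of_eval_eq fun x y => by rw [← hΦ, hPQ]
  rw [← hΦP]
  exact (MulEquiv.irreducible_iff Φ).symm

end Summit.Schanuel.Schanuel.Theorems
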